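import Mathlib
import HarnessLib
import Summits.Ventures.LatticeQCDFlow.Exactness.NCMCGeneralSpaceEstimatorConsistency

/-!
# Roots of a monotone estimating equation along an i.i.d. run: measurable selection and strong consistency

HONEST FRAMING: exact (Metropolis-corrected) sampling algorithms for lattice gauge theory;
figures of merit are autocorrelation/cost numbers at stated couplings and volumes; no
continuum-physics claim.

Venture `LatticeQCDFlow` (cell pub-lqcd), topic `Exactness`; FANOUT row 13 (`eng-snf`, GEN-15).
NEW WORK of the cell (elementary asymptotic statistics), not a published result; nothing is cited as
a fact ("Z-estimators" named only).  ABSTRACT form of `NCMCGeneralSpaceBennettRootConsistency.lean`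
(GEN-15 (38)): there the summand was one forward/reverse PAIR's Bennett term; the engine also solves
monotone equations whose summand is a BLOCK of `a` forward and `b` reverse evolutions (`nf ≠ nr`,
shift `M = log(nf/nr)`), or a pseudo-prior constant (`ncmc.c_from_works`).  This file isolates what
the argument uses: a summand `ψ_d(x)` that is measurable in the record `x` and strictly increasing in
the parameter `d`.

## Setting

A probability law `μ` on records `X`, a family `ψ : ℝ → X → ℝ` with `ψ_d` measurable and
`μ`-integrable for every `d` and `d ↦ ψ_d(x)` strictly increasing for every `x`; the i.i.d. run
`ω : ℕ → X` under `Measure.infinitePi (fun _ => μ)`; the sample equation after `n` records is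
`S_n(d, ω) = Σ_{i<n} ψ_d(ω i) = 0`, the population equation is `m(d) = E_μ ψ_d = 0`.

## Content

* `rootSum_monotone` / `rootSum_strictMono` / `measurable_rootSum` — bookkeeping.
* **`exists_measurable_root`** — if the sample equation has a root for every `n ≥ 1` and every run,
  a MEASURABLE root selection exists (`{d̂_n ≤ x} = {0 ≤ S_n(x, ·)}`).
* `strictMono_integral_family` — `m` is strictly increasing; `tendsto_rootSum_div_ae` — the strong
  law at a fixed `d`.
* **`eventually_rootSum_sign_ae`** — if `m(d⋆) = 0`: for a.e. run and every `δ > 0`, eventually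
  `S_n < 0` on `(−∞, d⋆ − δ]` and `S_n > 0` on `[d⋆ + δ, ∞)` (strong law at `d⋆ ± 1/(k+1)` +
  monotonicity); **`tendsto_root_ae`** — hence EVERY sequence solving the sample equation eventually
  converges to `d⋆` (one null set for all sequences); `tendsto_measurable_root_ae`.

Scope: strong consistency only (the central limit theorem of the root is the companion file
`NCMCGeneralSpaceMonotoneRootCLT.lean`); independent records.
-/

namespace Summit.Ventures.LatticeQCDFlow.Exactness.GeneralNCMC

open MeasureTheory ProbabilityTheory Set Filter Finset
open scoped ENNReal NNReal Topology

variable {X : Type*} [MeasurableSpace X]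

/-! ## The sample sum: monotone, measurable; a measurable root selection -/

section Sample

variable {ψ : ℝ → X → ℝ}

omit [MeasurableSpace X] in
/-- The sample sum `d ↦ Σ_{i<n} ψ_d(ω i)` is non-decreasing. -/
theorem rootSum_monotone (hstrict : ∀ x, StrictMono fun d => ψ d x) (ω : ℕ → X) (n : ℕ) :
    Monotone fun d : ℝ => ∑ i ∈ range n, ψ d (ω i) :=
  fun _ _ hab => sum_le_sum fun i _ => (hstrict (ω i)).monotone hab

omit [MeasurableSpace X] in
/-- … and strictly increasing once `n ≥ 1`. -/
theorem rootSum_strictMono (hstrict : ∀ x, StrictMono fun d => ψ d x) (ω : ℕ → X) {n : ℕ}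
    (hn : 1 ≤ n) : StrictMono fun d : ℝ => ∑ i ∈ range n, ψ d (ω i) :=
  fun _ _ hab => sum_lt_sum_of_nonempty (nonempty_range_iff.2 (by omega)) fun i _ => hstrict (ω i) hab

/-- The sample sum at a fixed `d` is a measurable function of the run. -/
theorem measurable_rootSum (hmeas : ∀ d, Measurable (ψ d)) (n : ℕ) (d : ℝ) :
    Measurable fun ω : ℕ → X => ∑ i ∈ range n, ψ d (ω i) :=
  Finset.measurable_sum _ fun i _ => (hmeas d).comp (measurable_pi_apply i)

/-- **A measurable root selection exists** as soon as the sample equation is solvable for every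
`n ≥ 1` and every run: `d̂ : ℕ → (ℕ → X) → ℝ` measurable in the run, with `S_n(d̂_n ω, ω) = 0`. -/
theorem exists_measurable_root (hmeas : ∀ d, Measurable (ψ d)) (hstrict : ∀ x, StrictMono fun d => ψ d x)
    (hex : ∀ n, 1 ≤ n → ∀ ω : ℕ → X, ∃ d : ℝ, ∑ i ∈ range n, ψ d (ω i) = 0) :
    ∃ dhat : ℕ → (ℕ → X) → ℝ, (∀ n, Measurable (dhat n)) ∧
      ∀ n, 1 ≤ n → ∀ ω, ∑ i ∈ range n, ψ (dhat n ω) (ω i) = 0 := by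
  classical
  refine ⟨fun n ω => if hn : 1 ≤ n then (hex n hn ω).choose else 0, fun n => ?_, fun n hn ω => ?_⟩
  · by_cases hn : 1 ≤ n
    · simp only [hn, dif_pos]
      refine measurable_of_Iic fun x => ?_
      have hset : (fun ω : ℕ → X => (hex n hn ω).choose) ⁻¹' Iic x =
          {ω | 0 ≤ ∑ i ∈ range n, ψ x (ω i)} := by
        ext ω
        simp only [Set.mem_preimage, Set.mem_Iic, Set.mem_setOf_eq]
        have hroot := (hex n hn ω).choose_spec
        constructor
        · intro hle
          rw [← hroot]
          exact rootSum_monotone hstrict ω n hle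
        · intro hge
          by_contra hlt
          have hlt' := rootSum_strictMono hstrict ω hn (lt_of_not_ge hlt)
          dsimp only at hlt'
          linarith
      rw [hset]
      exact measurableSet_le measurable_const (measurable_rootSum hmeas n x)
    · simp only [hn, dif_neg, not_false_eq_true]
      exact measurable_const
  · simp only [hn, dif_pos]
    exact (hex n hn ω).choose_spec

end Sample

/-! ## The population equation, the strong law at a fixed `d`, eventual sign separation -/

section Population

variable (μ : Measure X) [IsProbabilityMeasure μ]
variable {ψ : ℝ → X → ℝ}

/-- The population function `d ↦ E_μ ψ_d` is strictly increasing. -/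
theorem strictMono_integral_family (hstrict : ∀ x, StrictMono fun d => ψ d x)
    (hint : ∀ d, Integrable (ψ d) μ) :
    StrictMono fun d : ℝ => ∫ x, ψ d x ∂μ := by
  intro c c' hcc'
  have hsub : Integrable (fun x => ψ c' x - ψ c x) μ := (hint c').sub (hint c)
  have hpos : 0 < ∫ x, (ψ c' x - ψ c x) ∂μ := by
    rw [integral_pos_iff_support_of_nonneg (fun x => ?_) hsub]
    · have hsupp : Function.support (fun x => ψ c' x - ψ c x) = univ := by
        ext x
        simp only [Function.mem_support, mem_univ, iff_true]
        exact (sub_pos.2 (hstrict x hcc')).ne'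
      rw [hsupp, measure_univ]
      exact one_pos
    · exact sub_nonneg.2 ((hstrict x).monotone hcc'.le)
  rw [integral_sub (hint c') (hint c)] at hpos
  dsimp only
  linarith

/-- **Strong law at a fixed `d`**: `S_n(d, ω)/n → E_μ ψ_d` for almost every run. -/
theorem tendsto_rootSum_div_ae (hmeas : ∀ d, Measurable (ψ d)) (hint : ∀ d, Integrable (ψ d) μ)
    (d : ℝ) :
    ∀ᵐ ω ∂(Measure.infinitePi fun _ : ℕ => μ),
      Tendsto (fun n : ℕ => (∑ i ∈ range n, ψ d (ω i)) / n) atTop (𝓝 (∫ x, ψ d x ∂μ)) := by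
  filter_upwards [tendsto_sampleMean_ae μ (hmeas d) (hint d)] with ω hω
  refine hω.congr fun n => ?_
  unfold sampleMean
  rw [Fin.sum_univ_eq_sum_range (fun i => ψ d (ω i)) n]

/-- **Eventual sign separation around the population root.**  If `E_μ ψ_{d⋆} = 0` then for almost
every run and every `δ > 0`: for all large `n`, `S_n(d, ω) < 0` for `d ≤ d⋆ − δ` and `S_n(d, ω) > 0`
for `d ≥ d⋆ + δ`. -/
theorem eventually_rootSum_sign_ae (hmeas : ∀ d, Measurable (ψ d))
    (hstrict : ∀ x, StrictMono fun d => ψ d x) (hint : ∀ d, Integrable (ψ d) μ) {dstar : ℝ}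
    (hroot : ∫ x, ψ dstar x ∂μ = 0) :
    ∀ᵐ ω ∂(Measure.infinitePi fun _ : ℕ => μ), ∀ δ : ℝ, 0 < δ →
      ∀ᶠ n : ℕ in atTop,
        (∀ d ≤ dstar - δ, ∑ i ∈ range n, ψ d (ω i) < 0) ∧
        (∀ d ≥ dstar + δ, 0 < ∑ i ∈ range n, ψ d (ω i)) := by
  have hG := strictMono_integral_family μ hstrict hint
  have hup : ∀ᵐ ω ∂(Measure.infinitePi fun _ : ℕ => μ), ∀ k : ℕ,
      Tendsto (fun n : ℕ => (∑ i ∈ range n, ψ (dstar + 1 / (k + 1)) (ω i)) / n) atTop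
        (𝓝 (∫ x, ψ (dstar + 1 / (k + 1)) x ∂μ)) :=
    ae_all_iff.2 fun k => tendsto_rootSum_div_ae μ hmeas hint _
  have hdn : ∀ᵐ ω ∂(Measure.infinitePi fun _ : ℕ => μ), ∀ k : ℕ,
      Tendsto (fun n : ℕ => (∑ i ∈ range n, ψ (dstar - 1 / (k + 1)) (ω i)) / n) atTop
        (𝓝 (∫ x, ψ (dstar - 1 / (k + 1)) x ∂μ)) :=
    ae_all_iff.2 fun k => tendsto_rootSum_div_ae μ hmeas hint _
  filter_upwards [hup, hdn] with ω hωup hωdn δ hδ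
  obtain ⟨k, hk⟩ := exists_nat_one_div_lt hδ
  have hkpos : (0 : ℝ) < 1 / ((k : ℝ) + 1) := by positivity
  have hGup : 0 < ∫ x, ψ (dstar + 1 / (k + 1)) x ∂μ := by
    have := hG (show dstar < dstar + 1 / (k + 1) by linarith)
    dsimp only at this
    linarith
  have hGdn : ∫ x, ψ (dstar - 1 / (k + 1)) x ∂μ < 0 := by
    have := hG (show dstar - 1 / (k + 1) < dstar by linarith)
    dsimp only at this
    linarith
  filter_upwards [(hωup k).eventually (lt_mem_nhds hGup), (hωdn k).eventually (gt_mem_nhds hGdn),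
    eventually_gt_atTop 0] with n hnup hndn hn
  have hn' : (0 : ℝ) < n := by exact_mod_cast hn
  have hposup : 0 < ∑ i ∈ range n, ψ (dstar + 1 / (k + 1)) (ω i) := by
    by_contra hle
    have : (∑ i ∈ range n, ψ (dstar + 1 / (k + 1)) (ω i)) / n ≤ 0 :=
      div_nonpos_of_nonpos_of_nonneg (not_lt.1 hle) hn'.le
    linarith
  have hnegdn : ∑ i ∈ range n, ψ (dstar - 1 / (k + 1)) (ω i) < 0 := by
    by_contra hle
    have : 0 ≤ (∑ i ∈ range n, ψ (dstar - 1 / (k + 1)) (ω i)) / n :=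
      div_nonneg (not_lt.1 hle) hn'.le
    linarith
  have hmono := rootSum_monotone hstrict ω n
  constructor
  · intro d hd
    have h1 := hmono (show d ≤ dstar - 1 / (k + 1) by linarith)
    dsimp only at h1
    linarith
  · intro d hd
    have h1 := hmono (show dstar + 1 / (k + 1) ≤ d by linarith)
    dsimp only at h1
    linarith

/-- **Every root sequence converges to the population root** (one null set for all sequences). -/
theorem tendsto_root_ae (hmeas : ∀ d, Measurable (ψ d)) (hstrict : ∀ x, StrictMono fun d => ψ d x)
    (hint : ∀ d, Integrable (ψ d) μ) {dstar : ℝ} (hroot : ∫ x, ψ dstar x ∂μ = 0) :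
    ∀ᵐ ω ∂(Measure.infinitePi fun _ : ℕ => μ), ∀ dseq : ℕ → ℝ,
      (∀ᶠ n : ℕ in atTop, ∑ i ∈ range n, ψ (dseq n) (ω i) = 0) → Tendsto dseq atTop (𝓝 dstar) := by
  filter_upwards [eventually_rootSum_sign_ae μ hmeas hstrict hint hroot] with ω hω dseq hdseq
  rw [Metric.tendsto_atTop]
  intro ε hε
  obtain ⟨N, hN⟩ := ((hω ε hε).and hdseq).exists_forall_of_atTop
  refine ⟨N, fun n hn => ?_⟩
  obtain ⟨⟨hlo, hhi⟩, hz⟩ := hN n hn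
  rw [Real.dist_eq, abs_lt]
  constructor
  · by_contra hle
    have := hlo (dseq n) (by linarith)
    linarith
  · by_contra hle
    have := hhi (dseq n) (by linarith)
    linarith

/-- **A root selection converges almost surely**: if `d̂_n(ω)` solves the sample equation for every
`n ≥ 1`, then `d̂_n → d⋆` a.s. -/
theorem tendsto_measurable_root_ae (hmeas : ∀ d, Measurable (ψ d))
    (hstrict : ∀ x, StrictMono fun d => ψ d x) (hint : ∀ d, Integrable (ψ d) μ) {dstar : ℝ}
    (hroot : ∫ x, ψ dstar x ∂μ = 0) {dhat : ℕ → (ℕ → X) → ℝ}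
    (hdhat : ∀ n, 1 ≤ n → ∀ ω, ∑ i ∈ range n, ψ (dhat n ω) (ω i) = 0) :
    ∀ᵐ ω ∂(Measure.infinitePi fun _ : ℕ => μ), Tendsto (fun n => dhat n ω) atTop (𝓝 dstar) := by
  filter_upwards [tendsto_root_ae μ hmeas hstrict hint hroot] with ω hω
  exact hω (fun n => dhat n ω) (eventually_atTop.2 ⟨1, fun n hn => hdhat n hn ω⟩)

end Population

end Summit.Ventures.LatticeQCDFlow.Exactness.GeneralNCMC
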